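import Literature.AlgebraicGeometry.Motives.GeneratedAbelianSubvariety
import Literature.AlgebraicGeometry.Motives.AbelianVarietyBaseChange
import HarnessLib

/-!
# Generating morphisms are stable under extension of the base field

Topic `Literature/AlgebraicGeometry/Motives`, sequel of `GeneratedAbelianSubvariety` (Serre's sum maps
`s_n : (X × X)ⁿ⁺¹ → A` of a morphism `φ : X → A` to an abelian variety, and `Generates φ`: some `s_n`
is surjective; Serre, *Morphismes universels et variété d'Albanese*, no. 1 Déf. 1; Lang, *Abelian
Varieties*, II §3) and `AbelianVarietyBaseChange` (the base-change functor
`bcFunctor K L = Over.pullback (Spec L → Spec K)`, monoidal for the cartesian structures, and the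
abelian variety `A_L`). PROOF FILE: theorems and two auxiliary constructions with bodies — no named
fact, sorry-free (D-0026).

* (private) `isPullback_bcFunctor_map_left` — for every `K`-morphism `g : X → Y`, the square
  `X_L → Y_L` over `X → Y` is cartesian (Görtz–Wedhorn I, Prop. 4.16: transitivity of fibre
  products; public version: `GaloisDescent.isPullback_bcFunctor_map_left` in
  `Liu2021/NablaGaloisDescent`); hence `surjective_bcFunctor_map_left`: **`g_L` is surjective if `g` is**
  (Görtz–Wedhorn I, Prop. 4.32 (2); Mathlib `IsStableUnderBaseChange @Surjective`).
* (private plumbing) `pmPowBaseChangeIso L X n : ((X × X)ⁿ⁺¹)_L ≅ (X_L × X_L)ⁿ⁺¹` — the monoidal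
  structure isomorphisms of `bcFunctor`, iterated along the recursion of `pmPow`; `bcAV` — `A_L`
  presented on the nose as `(bcFunctor K L).obj A.X` with Mathlib's transported group structure
  (`= AbelianVariety.baseChange A L` by `rfl`); `bcFunctor_map_diffOf`, `bcFunctor_map_pmSum` —
  base change carries the difference map and the sum maps of `φ` to those of `φ_L : X_L → A_L`
  (the group law of `A_L` is the base change of that of `A`: Mathlib `Functor.map_mul`,
  `Functor.map_inv'`, `Functor.OplaxMonoidal.δ_fst/δ_snd`).
* `surjective_pmSum_baseChange_left` — `s_n(φ_L)` is surjective if `s_n(φ)` is.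
* **`Generates.baseChange`** — if `φ : X → A` generates `A`, then `φ_L : X_L → A_L` generates
  `A_L` (Lang, II §3, p. 35: the definition of "generates" is by generic surjectivity of a sum
  map, a property stable under extension of the ground field).

Mathlib searched and used: `Over.pullback` with its cartesian-monoidal structure
(`Mathlib.CategoryTheory.Monoidal.Cartesian.Over`), `Functor.Monoidal.μIso`,
`Functor.OplaxMonoidal.δ_fst`, `δ_snd`, `Functor.map_mul`, `Functor.map_inv'`, `MonObj.comp_mul`,
`GrpObj.comp_inv`, `tensorHom_fst`, `tensorHom_snd`, `IsPullback.of_right`,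
`IsPullback.of_hasPullback`, `MorphismProperty.of_isPullback`, the instances
`IsStableUnderBaseChange @Surjective`, `Surjective (f ≫ g)`, `[IsIso f] → Surjective f`.

## References

* [Serre1958MorphismesUniversels] J.-P. Serre, *Morphismes universels et variété d'Albanese*,
  Sém. Chevalley 4 (1958/59), exp. 10, no. 1 (Déf. 1, the maps `f_n`).
* [Lang1983AbelianVarieties] S. Lang, *Abelian Varieties* (1959/1983), II §3 (p. 35).
* [GortzWedhorn2020] U. Görtz, T. Wedhorn, *Algebraic Geometry I*, 2nd ed. (2020): Prop. 4.16
  (transitivity of fibre products), (4.7) (base change functor), Prop. 4.32 (2) (surjective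
  morphisms are stable under base change).
-/

noncomputable section

universe u

open CategoryTheory CategoryTheory.Limits AlgebraicGeometry MonoidalCategory CartesianMonoidalCategory

namespace Literature.AlgebraicGeometry.Motives

open scoped MonObj Obj
open AbelianVariety (bcSpec bcFunctor)

variable {K : Type u} [Field K] (L : Type u) [Field L] [Algebra K L]

/-! ### `g_L` is the base change of `g`; surjectivity is preserved -/

section IsPullback

variable {X Y : SchemeOver K} (g : X ⟶ Y)

/-- `g_L` commutes with the projections: `g_L ≫ pr_Y = pr_X ≫ g`. [folklore] -/
@[reassoc]
private theorem bcFunctor_map_left_comp_fst :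
    ((bcFunctor K L).map g).left ≫ pullback.fst Y.hom (bcSpec K L) =
      pullback.fst X.hom (bcSpec K L) ≫ g.left :=
  pullback.lift_fst _ _ _

/-- `g_L` is a morphism over `Spec L`. [folklore] -/
@[reassoc]
private theorem bcFunctor_map_left_comp_snd :
    ((bcFunctor K L).map g).left ≫ pullback.snd Y.hom (bcSpec K L) = pullback.snd X.hom (bcSpec K L) :=
  pullback.lift_snd _ _ _

/-- **`g_L : X_L → Y_L` is the base change of `g : X → Y`**: the square over `g` with the
projections `X_L → X`, `Y_L → Y` is cartesian (pasting of the cartesian squares defining `X_L` and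
`Y_L`; Görtz–Wedhorn I, Prop. 4.16).  Private twin of `GaloisDescent.isPullback_bcFunctor_map_left`
(`Liu2021/NablaGaloisDescent`), kept private here to avoid a `Motives → Liu2021` import.
[cite: GortzWedhorn2020, Prop. 4.16] -/
private theorem isPullback_bcFunctor_map_left :
    IsPullback ((bcFunctor K L).map g).left (pullback.fst X.hom (bcSpec K L))
      (pullback.fst Y.hom (bcSpec K L)) g.left := by
  refine IsPullback.of_right ?_ (bcFunctor_map_left_comp_fst L g)
    (IsPullback.of_hasPullback Y.hom (bcSpec K L)).flip
  rw [bcFunctor_map_left_comp_snd, Over.w g]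
  exact (IsPullback.of_hasPullback X.hom (bcSpec K L)).flip

/-- **Surjective morphisms stay surjective after extension of the base field** (Görtz–Wedhorn I,
Prop. 4.32 (2); Mathlib `IsStableUnderBaseChange @Surjective`). [cite: GortzWedhorn2020, Prop. 4.32 (2)] -/
theorem surjective_bcFunctor_map_left [Surjective g.left] : Surjective ((bcFunctor K L).map g).left :=
  MorphismProperty.of_isPullback (P := @Surjective) (isPullback_bcFunctor_map_left L g).flip ‹_›

end IsPullback

/-! ### Base change of the sum maps -/

section SumMaps

namespace AbelianVariety

variable (A : AbelianVariety K)

/-- `A_L` presented ON THE NOSE as the image of the group `K`-scheme `A` under the monoidal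
functor `bcFunctor K L` (Mathlib `Functor.grpObjObj`): a reducible twin of
`AbelianVariety.baseChange`, equal to it by `rfl` (`bcAV_eq_baseChange`), whose underlying
`L`-scheme is *syntactically* `(bcFunctor K L).obj A.X` — so that `(bcFunctor K L).map φ` is a
morphism to it without casts. [folklore] -/
private abbrev bcAV : AbelianVariety L where
  X := (bcFunctor K L).obj A.X
  grpObj := Functor.grpObjObj (F := bcFunctor K L) (G := A.X)
  isProper := by
    change IsProper (pullback.snd A.X.hom (bcSpec K L))
    infer_instance
  geometricallyIntegral := by
    change GeometricallyIntegral (pullback.snd A.X.hom (bcSpec K L))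
    infer_instance

/-- The twin IS `A_L` (`AbelianVariety.baseChange`), by `rfl`. [folklore] -/
private theorem bcAV_eq_baseChange : A.bcAV L = A.baseChange L := rfl

end AbelianVariety

variable {X : SchemeOver K} {A : AbelianVariety K} (φ : X ⟶ A.X)

/-- The base change `φ_L : X_L → A_L` of a `K`-morphism `φ : X → A` to an abelian variety, as a
morphism to the abelian variety `A_L` (in its presentation `AbelianVariety.bcAV`). [folklore] -/
private abbrev homBaseChange : (bcFunctor K L).obj X ⟶ (A.bcAV L).X := (bcFunctor K L).map φ

variable (X) in
/-- The monoidal structure isomorphisms `((X × X)ⁿ⁺¹)_L ≅ (X_L × X_L)ⁿ⁺¹` of the base-change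
functor, along the recursion `X_{n+1} = X_n × (X × X)` of `pmPow`. [folklore] -/
private def pmPowBaseChangeIso : (n : ℕ) →
    ((bcFunctor K L).obj (pmPow X n) ≅ pmPow ((bcFunctor K L).obj X) n)
  | 0 => (Functor.Monoidal.μIso (bcFunctor K L) X X).symm
  | n + 1 => (Functor.Monoidal.μIso (bcFunctor K L) (pmPow X n) (X ⊗ X)).symm ≪≫
      tensorIso (pmPowBaseChangeIso n) (Functor.Monoidal.μIso (bcFunctor K L) X X).symm

/-- In degree `0` the isomorphism is the oplax structure map `δ : (X × X)_L → X_L × X_L`.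
[folklore] -/
private theorem pmPowBaseChangeIso_zero_hom :
    (pmPowBaseChangeIso L X 0).hom = Functor.OplaxMonoidal.δ (bcFunctor K L) X X := rfl

/-- `e₀ ≫ pr₁ = (pr₁)_L`. [folklore] -/
@[reassoc]
private theorem pmPowBaseChangeIso_zero_hom_fst :
    (pmPowBaseChangeIso L X 0).hom ≫ fst _ _ = (bcFunctor K L).map (fst X X) := by
  rw [pmPowBaseChangeIso_zero_hom, Functor.OplaxMonoidal.δ_fst]

/-- `e₀ ≫ pr₂ = (pr₂)_L`. [folklore] -/
@[reassoc]
private theorem pmPowBaseChangeIso_zero_hom_snd :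
    (pmPowBaseChangeIso L X 0).hom ≫ snd _ _ = (bcFunctor K L).map (snd X X) := by
  rw [pmPowBaseChangeIso_zero_hom, Functor.OplaxMonoidal.δ_snd]

/-- `e_{n+1} ≫ pr₁ = (pr₁)_L ≫ e_n`. [folklore] -/
@[reassoc]
private theorem pmPowBaseChangeIso_succ_hom_fst (n : ℕ) :
    (pmPowBaseChangeIso L X (n + 1)).hom ≫ fst _ _ =
      (bcFunctor K L).map (fst (pmPow X n) (X ⊗ X)) ≫ (pmPowBaseChangeIso L X n).hom := by
  change ((Functor.Monoidal.μIso (bcFunctor K L) (pmPow X n) (X ⊗ X)).inv ≫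
    ((pmPowBaseChangeIso L X n).hom ⊗ₘ (Functor.Monoidal.μIso (bcFunctor K L) X X).inv)) ≫
      fst _ _ = _
  rw [Category.assoc, tensorHom_fst, Functor.Monoidal.μIso_inv,
    Functor.OplaxMonoidal.δ_fst_assoc]

/-- `e_{n+1} ≫ pr₂ = (pr₂)_L ≫ e₀`. [folklore] -/
@[reassoc]
private theorem pmPowBaseChangeIso_succ_hom_snd (n : ℕ) :
    (pmPowBaseChangeIso L X (n + 1)).hom ≫ snd _ _ =
      (bcFunctor K L).map (snd (pmPow X n) (X ⊗ X)) ≫ (pmPowBaseChangeIso L X 0).hom := by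
  change ((Functor.Monoidal.μIso (bcFunctor K L) (pmPow X n) (X ⊗ X)).inv ≫
    ((pmPowBaseChangeIso L X n).hom ⊗ₘ (Functor.Monoidal.μIso (bcFunctor K L) X X).inv)) ≫
      snd _ _ = _
  rw [Category.assoc, tensorHom_snd, Functor.Monoidal.μIso_inv,
    Functor.OplaxMonoidal.δ_snd_assoc]
  rfl

/-- **Base change of the difference map**: `(d_φ)_L = e₀ ≫ d_{φ_L}`, i.e.
`(φ(x) φ(y)⁻¹)_L = φ_L(x) φ_L(y)⁻¹` on `(X × X)_L ≅ X_L × X_L` (the group law of `A_L` is the base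
change of that of `A`). [cite: Serre1958MorphismesUniversels, no. 1] -/
private theorem bcFunctor_map_diffOf :
    (bcFunctor K L).map (diffOf φ) = (pmPowBaseChangeIso L X 0).hom ≫ diffOf (homBaseChange L φ) := by
  unfold diffOf
  rw [MonObj.comp_mul, GrpObj.comp_inv, pmPowBaseChangeIso_zero_hom_fst_assoc,
    pmPowBaseChangeIso_zero_hom_snd_assoc, ← Functor.map_comp, ← Functor.map_comp,
    Functor.map_mul, Functor.map_inv']

/-- **Base change of the sum maps**: `(s_n)_L = e_n ≫ s_n(φ_L)` for every `n` (induction along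
`s_{n+1}(z, w) = s_n(z) · d(w)`). [cite: Serre1958MorphismesUniversels, no. 1] -/
private theorem bcFunctor_map_pmSum : ∀ n : ℕ,
    (bcFunctor K L).map (pmSum φ n) = (pmPowBaseChangeIso L X n).hom ≫ pmSum (homBaseChange L φ) n
  | 0 => bcFunctor_map_diffOf L φ
  | n + 1 => by
    rw [pmSum_succ, pmSum_succ, MonObj.comp_mul, pmPowBaseChangeIso_succ_hom_fst_assoc,
      pmPowBaseChangeIso_succ_hom_snd_assoc, ← bcFunctor_map_pmSum n, ← bcFunctor_map_diffOf,
      ← Functor.map_comp, ← Functor.map_comp, Functor.map_mul]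

/-- The sum maps of `φ_L` are those of `φ`, base-changed, up to the structure isomorphism.
[folklore] -/
private theorem pmSum_homBaseChange (n : ℕ) :
    pmSum (homBaseChange L φ) n = (pmPowBaseChangeIso L X n).inv ≫ (bcFunctor K L).map (pmSum φ n) := by
  rw [bcFunctor_map_pmSum, Iso.inv_hom_id_assoc]

/-- The sum maps of `φ_L` are surjective where those of `φ` are (presentation `A.bcAV L`).
[folklore] -/
private theorem surjective_pmSum_homBaseChange_left (n : ℕ) [Surjective (pmSum φ n).left] :
    Surjective (pmSum (homBaseChange L φ) n).left := by
  rw [pmSum_homBaseChange, Over.comp_left]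
  haveI : IsIso (pmPowBaseChangeIso L X n).inv.left :=
    ((Over.forget _).mapIso (pmPowBaseChangeIso L X n).symm).isIso_hom
  haveI := surjective_bcFunctor_map_left L (pmSum φ n)
  infer_instance

/-- **The sum maps of `φ_L : X_L → A_L` are surjective where those of `φ` are**: Serre's
`f_n` for `φ_L` is the base change of `f_n` for `φ` up to the structure isomorphism
`((X × X)ⁿ⁺¹)_L ≅ (X_L × X_L)ⁿ⁺¹`, and surjectivity is stable under base change
(Görtz–Wedhorn I, Prop. 4.32 (2)). [cite: Serre1958MorphismesUniversels, no. 1]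
[cite: GortzWedhorn2020, Prop. 4.32 (2)] -/
theorem surjective_pmSum_baseChange_left (n : ℕ) [Surjective (pmSum φ n).left] :
    Surjective (pmSum (A := A.baseChange L) ((bcFunctor K L).map φ) n).left :=
  surjective_pmSum_homBaseChange_left L φ n

/-- Generation is preserved in the presentation `A.bcAV L` of `A_L`. [folklore] -/
private theorem Generates.homBaseChange (hφ : Generates φ) : Generates (homBaseChange L φ) := by
  obtain ⟨n, hn⟩ := hφ
  exact ⟨n, surjective_pmSum_homBaseChange_left L φ n⟩

/-- **Generating morphisms are stable under extension of the base field**: if `φ : X → A`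
generates `A` (some sum map `s_n : (X × X)ⁿ⁺¹ → A` is surjective; Serre, Déf. 1; Lang, II §3),
then `φ_L : X_L → A_L` generates `A_L = AbelianVariety.baseChange A L`, since
`s_n(φ_L) = (s_n)_L` up to isomorphism and surjectivity is stable under base change.
[cite: Lang1983AbelianVarieties, II §3 (p. 35)] [cite: GortzWedhorn2020, Prop. 4.32 (2)] -/
theorem Generates.baseChange (hφ : Generates φ) :
    Generates (A := A.baseChange L) ((bcFunctor K L).map φ) :=
  hφ.homBaseChange L

end SumMaps

end Literature.AlgebraicGeometry.Motives

end
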